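import Literature.Claims.NS.Kampen2015
import HarnessLib

/-!
# C13b `Kampen2015` (arXiv:1502.06699 v3, «Some new consequences of the CKN-theory») — refuter's
# kernel kills inside the printed proof of Lemma 2.1 (54) p. 12
(cell `ns-claims`, D-0090; refuter `ns-claims-refuter-7`; referee `ns-claims-ref-3`; skeleton
`Literature.Claims.NS.Kampen2015` p474485 by typist-12, whose KILL TARGETS line 2026-08-26T23:22:11Z
pre-registered both witnesses below)

* `not_Step_3` refutes `Literature.Claims.NS.Kampen2015.Step_3` = (61) ⇒ (62) p. 13: from
  `Σ_β |β|² v_β(t)² < ∞` for EACH `t ∈ [t₁,t_s]` the print takes `sup_{t ∈ [t₁,t_s]} c*(t) =: c < ∞` (the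
  «global constants» of Lemma 2.1, p. 12). Typed at the abstract grain: a nonnegative real family on
  `[t₁,t_s]` is bounded above. WITNESS `t₁ = 0`, `t_s = 1`, `N(t) = 1/(1 − t)` (Lean's `1/0 = 0` at
  `t = 1` keeps it nonnegative): `N(1 − 1/(|c| + 2)) = |c| + 2 > c`. [refuted-substantive at the typed
  grain: pointwise finiteness of `‖v(t)‖_{H¹}` gives no uniform bound — `L²_t H¹_x` is all a Leray–Hopf
  solution has.]
* `not_Step_5` refutes `Literature.Claims.NS.Kampen2015.Step_5` = (64) ⇒ «Hence for n ≤ 3 we have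
  p,i(t,·) ∈ L²» p. 13, the LAST inference of the printed proof of Lemma 2.1: square-summability over
  `ℤ³` of the printed mode bound `|p,iα| ≤ n²c|2πα_i|/Σ_i 4π²α_i²`. WITNESS `c = 1` and the injective
  subfamily `α = (k+1, m, 0)`, `k, m ∈ ℕ`: for `m ≤ k` the squared bound is `≥ 81/(16π²(k+1)²)`, so the
  `k`-th fibre sum is `≥ 81/(16π²(k+1))` — a harmonic minorant; `Σ_{α ≠ 0} α_1²/|α|⁴ = (1/3)Σ|α|^{−2} = ∞`
  on `ℤ³`. [refuted-substantive: the print's reason «the factor α_i in the numerator occurs only on one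
  dimension … the remaining n − 1 dimensional sum is also finite for n ≤ 3» is false.]

Both displays sit inside Lemma 2.1 (54) p. 12 («p,i ∈ L² … the upper bound constants used are
global»), the pressure input of the transfer (53)+(67)–(85) pp. 14–16 (`Step_7`). The earlier cone
bounds (12)/(14) p. 3 (`Step_1`/`Step_2`, asserted from integrability with no derivation) are
PDE-grain statements not attacked here.

WHAT THIS IS NOT: not a claim about the Navier–Stokes problem itself; not a claim about any author
beyond the typed locator.
-/

set_option linter.dupNamespace false

open Finset

namespace Summit.NavierStokesRegularity.NavierStokesRegularity.Theorems.Kampen2015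

open Literature.Claims.NS.Kampen2015

noncomputable section

/-! ## (61) ⇒ (62): pointwise finite does not mean bounded -/

/-- **Refutes `Kampen2015.Step_3` = (61) ⇒ (62) p. 13 [refuted-substantive]**: the nonnegative family
`N(t) = 1/(1 − t)` on `[0, 1]` (value `0` at `t = 1` by `1/0 = 0`) has no upper bound: given `c`, the
time `t = 1 − 1/(|c| + 2) ∈ [0,1]` has `N(t) = |c| + 2 > c`. No side condition of the print is missed:
(61) is exactly «for each t», (62) exactly «sup over [t₁,t_s]». [cite: Kampen2015CKN, (61)–(63) p. 13;
Lemma 2.1 p. 12] -/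
theorem not_Step_3 : ¬ Literature.Claims.NS.Kampen2015.Step_3 := by
  intro h
  obtain ⟨c, hc⟩ := h 0 1 one_pos (fun t => 1 / (1 - t)) (fun t ht => by
    rcases eq_or_lt_of_le ht.2 with h1 | h1
    · simp [h1]
    · exact div_nonneg zero_le_one (by linarith))
  have hpos : (0 : ℝ) < |c| + 2 := by positivity
  have ht : 1 - 1 / (|c| + 2) ∈ Set.Icc (0 : ℝ) 1 := by
    constructor
    · rw [sub_nonneg, div_le_one hpos]; linarith [abs_nonneg c]
    · rw [sub_le_self_iff]; positivity
  have key := hc _ ht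
  have hval : 1 / (1 - (1 - 1 / (|c| + 2))) = |c| + 2 := by
    field_simp
    ring
  rw [hval] at key
  linarith [le_abs_self c]

/-! ## (64) ⇒ «p,i(t,·) ∈ L²»: the squared mode bound is not summable over `ℤ³` -/

/-- The injective subfamily `(k, m) ↦ (k+1, m, 0)` of the lattice `ℤ³`. -/
def subfam (p : ℕ × ℕ) : Fin 3 → ℤ := ![(p.1 : ℤ) + 1, (p.2 : ℤ), 0]

/-- `subfam` is injective. -/
theorem subfam_injective : Function.Injective subfam := by
  intro p q hpq
  have h0 := congrFun hpq 0
  have h1 := congrFun hpq 1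
  simp only [subfam, Matrix.cons_val_zero, Matrix.cons_val_one, add_left_inj,
    Nat.cast_inj] at h0 h1
  exact Prod.ext h0 h1

/-- The printed bound (64) with `c = 1` on the subfamily: `pModeBound 1 (k+1, m, 0) =
18π(k+1) / (4π²((k+1)² + m²))`. -/
theorem pModeBound_subfam (k m : ℕ) :
    pModeBound 1 (subfam (k, m)) =
      18 * Real.pi * ((k : ℝ) + 1) / (4 * Real.pi ^ 2 * (((k : ℝ) + 1) ^ 2 + (m : ℝ) ^ 2)) := by
  have hne : subfam (k, m) ≠ 0 := by
    intro h
    have h0 := congrFun h 0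
    simp only [subfam, Matrix.cons_val_zero, Pi.zero_apply] at h0
    omega
  have hk : (0 : ℝ) < (k : ℝ) + 1 := by positivity
  rw [pModeBound, if_neg hne]
  simp only [subfam, Fin.sum_univ_three, Matrix.cons_val_zero, Matrix.cons_val_one,
    Matrix.cons_val_two, Matrix.tail_cons, Matrix.head_cons, Int.cast_add, Int.cast_natCast,
    Int.cast_one, Int.cast_zero]
  rw [abs_of_pos (by positivity)]
  ring

/-- On the triangle `m ≤ k` the squared bound dominates `81/(16π²(k+1)²)`. -/
theorem sq_pModeBound_subfam_ge {k m : ℕ} (hm : m ≤ k) :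
    81 / (16 * Real.pi ^ 2 * ((k : ℝ) + 1) ^ 2) ≤ pModeBound 1 (subfam (k, m)) ^ 2 := by
  rw [pModeBound_subfam]
  have hk : (0 : ℝ) < (k : ℝ) + 1 := by positivity
  have hπ : (0 : ℝ) < Real.pi := Real.pi_pos
  have hmk : (m : ℝ) ≤ (k : ℝ) := by exact_mod_cast hm
  have hm0 : (0 : ℝ) ≤ (m : ℝ) := by positivity
  -- `(k+1)² + m² ≤ 2 (k+1)²`
  have hden : ((k : ℝ) + 1) ^ 2 + (m : ℝ) ^ 2 ≤ 2 * ((k : ℝ) + 1) ^ 2 := by nlinarith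
  have hdenpos : 0 < ((k : ℝ) + 1) ^ 2 + (m : ℝ) ^ 2 := by positivity
  -- the bound itself dominates `9/(4π(k+1))`
  have hlow : 9 / (4 * Real.pi * ((k : ℝ) + 1)) ≤
      18 * Real.pi * ((k : ℝ) + 1) / (4 * Real.pi ^ 2 * (((k : ℝ) + 1) ^ 2 + (m : ℝ) ^ 2)) := by
    rw [div_le_div_iff₀ (by positivity) (by positivity)]
    nlinarith [mul_pos hπ hk, mul_pos (mul_pos hπ hπ) hk]
  have h0 : (0 : ℝ) ≤ 9 / (4 * Real.pi * ((k : ℝ) + 1)) := by positivity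
  calc 81 / (16 * Real.pi ^ 2 * ((k : ℝ) + 1) ^ 2) = (9 / (4 * Real.pi * ((k : ℝ) + 1))) ^ 2 := by
        field_simp
        ring
    _ ≤ _ := pow_le_pow_left₀ h0 hlow 2

/-- **Refutes `Kampen2015.Step_5` = (64) ⇒ «Hence for n ≤ 3 we have p,i(t,·) ∈ L²» p. 13
[refuted-substantive]**: with `c = 1`, summability over `ℤ³` of the squared printed bound would give
summability on the injective subfamily `(k+1, m, 0)`, whose `k`-th fibre sum over `m` is at least
`Σ_{m ≤ k} 81/(16π²(k+1)²) = 81/(16π²(k+1))`; the fibre sums are then a summable majorant of a harmonic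
series — contradiction (`Real.not_summable_one_div_natCast`). [cite: Kampen2015CKN, (64) p. 13;
Lemma 2.1 (54) p. 12] -/
theorem not_Step_5 : ¬ Literature.Claims.NS.Kampen2015.Step_5 := by
  intro h
  have hF : Summable (fun p : ℕ × ℕ => pModeBound 1 (subfam p) ^ 2) :=
    (h 1 one_pos).comp_injective subfam_injective
  have hnn : 0 ≤ fun p : ℕ × ℕ => pModeBound 1 (subfam p) ^ 2 := fun p => sq_nonneg _
  obtain ⟨hfib, hsum⟩ := (summable_prod_of_nonneg hnn).1 hF
  -- fibre sums dominate a harmonic series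
  have hlb : ∀ k : ℕ, 81 / (16 * Real.pi ^ 2 * ((k : ℝ) + 1)) ≤
      ∑' m : ℕ, pModeBound 1 (subfam (k, m)) ^ 2 := by
    intro k
    have hk : (0 : ℝ) < (k : ℝ) + 1 := by positivity
    calc 81 / (16 * Real.pi ^ 2 * ((k : ℝ) + 1))
        = ∑ _m ∈ range (k + 1), 81 / (16 * Real.pi ^ 2 * ((k : ℝ) + 1) ^ 2) := by
          rw [sum_const, card_range, nsmul_eq_mul]
          push_cast
          field_simp
      _ ≤ ∑ m ∈ range (k + 1), pModeBound 1 (subfam (k, m)) ^ 2 :=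
          sum_le_sum fun m hm => sq_pModeBound_subfam_ge (Nat.lt_succ_iff.1 (mem_range.1 hm))
      _ ≤ ∑' m : ℕ, pModeBound 1 (subfam (k, m)) ^ 2 :=
          (hfib k).sum_le_tsum (range (k + 1)) fun m _ => sq_nonneg _
  have hharm : Summable (fun k : ℕ => 81 / (16 * Real.pi ^ 2 * ((k : ℝ) + 1))) :=
    Summable.of_nonneg_of_le (fun k => by positivity) hlb hsum
  have hone : Summable (fun k : ℕ => 1 / ((k : ℝ) + 1)) := by
    refine (hharm.mul_left (16 * Real.pi ^ 2 / 81)).congr fun k => ?_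
    have hk : (0 : ℝ) < (k : ℝ) + 1 := by positivity
    field_simp
  have hshift : Summable (fun k : ℕ => 1 / ((k + 1 : ℕ) : ℝ)) := by
    refine hone.congr fun k => ?_
    push_cast
    rfl
  exact Real.not_summable_one_div_natCast ((summable_nat_add_iff 1).1 hshift)

end

end Summit.NavierStokesRegularity.NavierStokesRegularity.Theorems.Kampen2015
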